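import Summits.QuantumFields.BalabanUV.T4Continuum.Support.ApproxRefineGradReduce
import Summits.QuantumFields.BalabanUV.T4Continuum.Support.ApproxRefineRegime
import Summits.QuantumFields.BalabanUV.T4Continuum.Support.SkeletonFillFullCovGrad

/-!
# T⁴ programme, node NE3 — kinematic refinement lemma, row R1-asm, part 3c: **THE R1 END** — `approxRefine_sfClass`,
# the owner's socket `SmoothRefineOfApprox.ApproxRefine` for the small-field classes with CLOSED `b₁ c₁ m`, NO hypothesis
# beyond displayed `j`-uniform smallness of `(b, c)`

NE3 formalisation swarm, LEAF PROVER 09 gen 2 (unit `b2b-balaban-t4-ne3-formalise-leaf-09`), row **R1-asm** of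
`t4/formal/NE3/LEAVES.md` (owner RULING NE3-R1-ASSEMBLY; gen-1 HANDOFF (2) «part 3c = instantiate ρ»).  After part 3b
(`ApproxRefineGradReduce.approxRefine_of_rootClose`, p213202) the socket was open modulo ONE number: a scaled
root-closeness radius `r/(L^j)³ ≥ ‖W(∂p_{μν}(L•z+q)) − h(z;μ,ν)‖` of the filling `W = fullFill L T h`,
`T = precomp L U`, `h = rootH L T`, of every class-`j` regular `U`.  Row S4d's F4e
(`SkeletonFillFullCovGrad.norm_plaq_sub_root_le`, leaf-04 g2 by arrangement with leaf-07) delivers that radius for ANY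
unitary skeleton datum with root data `(a₀, δ)` and the root identity `h^{L²} = T(∂p)`:
`ρ⋆(a₀, δ) = 2d(L−1)δ + 2d(L−1)Lδ + 14·S²`, `S = d(L−1)a₀ + d(L−1)La₀ + L²a₀` — NO term linear in `a₀`.  THIS FILE
plugs in part 2b's root data of the pre-compensated datum (`ApproxRefineRootData.rootData_precomp`:
`a₀ = L^{−2}·4A/(L^j)²`, `δ = 12L^{−2}·G₀/(L^j)³`, `A = (8d−7)b`, `G₀ = (2d−1)c + gradRem(d)b²`) and closes the row
([folklore] bookkeeping; 0 defs, 0 sorry; imports part 3b, the regime file p213660 and row S4d's F4e):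
* `scale_rootClose` — pure real arithmetic: `ρ⋆(a₀, δ) ≤ (24dG₀ + 224(d+1)²A²)/(L^j)³` (uses `(L−1)(L+1)L^{−2} ≤ 1`,
  `(d(L²−1) + L²)L^{−2} ≤ d+1`, `(L^j)^{−4} ≤ (L^j)^{−3}`);
* **`rootClose_fill_of_regularSup`** — for a class-`j` regular `U` (`RegularSup d L N b c j U`, `0 ≤ b, c`,
  `(d−1)b ≤ 1/32`, `(8d−7)b ≤ 1/4`): every fine plaquette of the filling of `precomp L U` is within `r/(L^j)³`,
  **`r = 24dG₀ + 224(d+1)²A²`**, of its cell's root — F4e §1 with the root identity from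
  `SkeletonFillUnitary.rootH_pow` (plaquettes of `T` within `1/4` of `1`, `skeletonDatum_precomp_of_regularSup`) and
  the unitarity of the roots from `rootH_mem_unitary`;
* **`approxRefine_sfClass`** — THE R1 END: `ApproxRefine d (sfClass d L N ε) L N b c b₁ c₁ m` with
  `b₁ = 4A + 48dL²G₀ + 128(2d+1)²L²A²` (part 3a), `c₁ = L³(32dA(4A + r + 12G₀) + 4r + 24G₀)` (part 3b at this `r`),
  `m = 3(1280d(d+1)²(d+4)²L²b₁² + d(d+1)c₁ + (d−1)²(c + (37(d−1)+4)b²))` (part 2) — polynomials in `(d, L, b, c)` with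
  NO constant term and NO `L^j` — under FIVE displayed `j`-uniform numeric inequalities on `(b, c)`
  (`h16 hdb hquarter hhalf h512`) and NOTHING ELSE: part 3b's `approxRefine_of_rootClose` at
  `hρ := rootClose_fill_of_regularSup`;
* `approxRefine_sfClass_of_small` — the same under ONE threshold `K(d, L)·t ≤ 1` for `b, c ≤ t` (the five inequalities
  by `ApproxRefineRegime.sideConds_of_small`, p213660); the linear envelopes `b₁ ≤ K_b·t`
  (`ApproxRefineRegime.fillRadius_le_of_small`) and `m ≤ K_m·t` (owner's
  `MinimalActionMismatchSmall.mismatch_le_of_small`, (48S-a)) of these very expressions feed the owner's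
  `MinimalActionFinalApprox.actionRate_sfClass_of_exists_approx_linear` (47S).
With the owner's `SmoothRefineOfApprox.smoothRefine_of_approxRefine` (p211841) this gives
`MinimalActionRefine.SmoothRefine` for the small-field classes, and with `MinimalActionRateExists` ∕
`MinimalActionRegime` the route-(A) END reads «NE3-(A) for small-field data CONDITIONAL on (H∃) [B11 Thm 1 TYPE]
modulo the numeric regime» — the kinematic input `ApproxRefine` is no longer a hypothesis of it.

HONEST FRAMING.  Composition of landed lemmas for a kinematic construction (one configuration, one refinement step);
no minimiser, no variational problem; no printed sentence is a hypothesis; everything imported BY NAME; no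
`def … : Prop`, no definition, no `sorry`; axioms ⊆ {propext, Classical.choice, Quot.sound}.  **NE3 is NOT proved**
((H∃) = B11 Thm 1 TYPE and the LOCAL half of `T4EtaRateMin.NE3Shape` remain); spine PROVED 0/9; `BetaPertH`, (B),
G-an2-4 occur nowhere; finite T⁴ rung (B)+1 — NOT infinite volume, NOT a mass gap, NOT the Clay problem.  HONEST
DEPENDENCY (cell page 1): continuum YM on T⁴ ⇐ BetaPertH ∧ nine spine estimates (0/9 proved); BetaPertH ⇐ (D1) ∧ (D4)
∧ CAP+tail; G-an2-4 gates asym, D1 and NE2/3/4.  PLACEMENT (human rule 2026-08-19): under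
`Summits/QuantumFields/BalabanUV/`; imports tree modules only (part 3b + row S4d F4e); moves nothing.  Credits:
F4b–F4e leaf-04 g2 (arrangement with leaf-07, row S4d), F1–F3 leaf-07, S4c leaf-01, S4e leaf-08, parts 1–3b leaf-09
gen 1.
-/

set_option autoImplicit false

open scoped BigOperators Matrix Matrix.Norms.L2Operator
open NormedSpace

namespace Summit.QuantumFields.BalabanUV.T4Continuum.ApproxRefineEnd

open Literature.MathematicalPhysics.QuantumFieldTheory.Balaban1983to89
open B7Prop1Explicit B7Prop2Explicit MatrixLog UnitaryModel
open T4AveragingDeficitWall hiding Site Plane Plaq Bond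
open MinimalActionRate (sfClass)
open MinimalActionRefine (RegularSup)
open SkeletonFillUnitary (rootH rootCoeff rootCoeff_nonneg rootCoeff_le_one rootH_mem_unitary rootH_pow)
open SkeletonFillFull (fullFill InBox)
open SkeletonPrecomp (precomp precompCoeff)
open SkeletonPrecompGrad (gradRem gradRem_nonneg)
open SmoothRefineOfApprox (ApproxRefine)
open ApproxRefineRootData (rootData_precomp)
open ApproxRefineAssembly (skeletonDatum_precomp_of_regularSup)
open ApproxRefineGradReduce (approxRefine_of_rootClose)
open ApproxRefineRegime (sideConds_of_small)
open SkeletonFillFullCovGrad (norm_plaq_sub_root_le)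

noncomputable section

variable {d : ℕ} {n : Type*} [Fintype n] [DecidableEq n]

/-! ## §1 Scale bookkeeping (pure real arithmetic) -/

/-- F4e's root-closeness radius at scaled root data: with `a₀ = L^{−2}·4A/s²`, `δ = 12L^{−2}·G₀/s³`, `s ≥ 1`, `L ≥ 1`,
`A, G₀ ≥ 0`:  `2d(L−1)δ + 2d(L−1)Lδ + 14(d(L−1)a₀ + d(L−1)La₀ + L²a₀)² ≤ (24dG₀ + 224(d+1)²A²)/s³`. [folklore] -/
theorem scale_rootClose (d L : ℕ) (hL : 1 ≤ L) {s A G₀ : ℝ} (hs : 1 ≤ s) (hA : 0 ≤ A) (hG : 0 ≤ G₀) :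
    2 * (d * ((L - 1 : ℕ) * (12 * rootCoeff L * (G₀ / s ^ 3))))
        + 2 * (d * (((L - 1 : ℕ) * L) * (12 * rootCoeff L * (G₀ / s ^ 3))))
        + 14 * (d * ((L - 1 : ℕ) * (rootCoeff L * (4 * (A / s ^ 2))))
            + d * (((L - 1 : ℕ) * L) * (rootCoeff L * (4 * (A / s ^ 2))))
            + L * L * (rootCoeff L * (4 * (A / s ^ 2)))) ^ 2
      ≤ (24 * d * G₀ + 224 * ((d : ℝ) + 1) ^ 2 * A ^ 2) / s ^ 3 := by
  have hL1 : (1 : ℝ) ≤ L := by exact_mod_cast hL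
  have hL0 : (0 : ℝ) < L := by linarith
  have hs0 : 0 < s := by linarith
  have hd0 : (0 : ℝ) ≤ d := by positivity
  have hLm : ((L - 1 : ℕ) : ℝ) = L - 1 := by rw [Nat.cast_sub hL, Nat.cast_one]
  have hrc : rootCoeff L = 1 / (L : ℝ) ^ 2 := by unfold rootCoeff; rw [one_div]
  set a₀ : ℝ := rootCoeff L * (4 * (A / s ^ 2)) with ha0def
  set δ' : ℝ := 12 * rootCoeff L * (G₀ / s ^ 3) with hδdef
  have ha00 : 0 ≤ a₀ := by rw [ha0def]; exact mul_nonneg (rootCoeff_nonneg L) (by positivity)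
  have hδ0 : 0 ≤ δ' := by
    rw [hδdef]; exact mul_nonneg (mul_nonneg (by norm_num) (rootCoeff_nonneg L)) (by positivity)
  have hL2a : (L : ℝ) ^ 2 * a₀ = 4 * A / s ^ 2 := by rw [ha0def, hrc]; field_simp
  have hL2δ : (L : ℝ) ^ 2 * δ' = 12 * G₀ / s ^ 3 := by rw [hδdef, hrc]; field_simp
  -- (i) the `δ`-part: `2dδ(L−1)(1+L) = 2dδ(L²−1) ≤ 2dL²δ = 24dG₀/s³`
  have hδpart : 2 * (d * ((L - 1 : ℕ) * δ')) + 2 * (d * (((L - 1 : ℕ) * L) * δ')) ≤ 24 * d * G₀ / s ^ 3 := by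
    rw [hLm]
    have e : 2 * (d * (((L : ℝ) - 1) * δ')) + 2 * (d * ((((L : ℝ) - 1) * L) * δ'))
        = 2 * d * (((L : ℝ) ^ 2 - 1) * δ') := by ring
    rw [e]
    calc 2 * d * (((L : ℝ) ^ 2 - 1) * δ') ≤ 2 * d * ((L : ℝ) ^ 2 * δ') := by
          apply mul_le_mul_of_nonneg_left _ (by positivity)
          exact mul_le_mul_of_nonneg_right (by linarith) hδ0
      _ = 24 * d * G₀ / s ^ 3 := by rw [hL2δ]; ring
  -- (ii) the `S`-part: `S = (d(L²−1) + L²)a₀ ≤ (d+1)L²a₀ = 4(d+1)A/s²`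
  have hS : d * ((L - 1 : ℕ) * a₀) + d * (((L - 1 : ℕ) * L) * a₀) + L * L * a₀ ≤ 4 * ((d : ℝ) + 1) * A / s ^ 2 := by
    rw [hLm]
    have e : d * (((L : ℝ) - 1) * a₀) + d * ((((L : ℝ) - 1) * L) * a₀) + L * L * a₀
        = ((d : ℝ) * ((L : ℝ) ^ 2 - 1) + (L : ℝ) ^ 2) * a₀ := by ring
    rw [e]
    calc ((d : ℝ) * ((L : ℝ) ^ 2 - 1) + (L : ℝ) ^ 2) * a₀ ≤ (((d : ℝ) + 1) * (L : ℝ) ^ 2) * a₀ := by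
          apply mul_le_mul_of_nonneg_right _ ha00; nlinarith
      _ = ((d : ℝ) + 1) * ((L : ℝ) ^ 2 * a₀) := by ring
      _ = 4 * ((d : ℝ) + 1) * A / s ^ 2 := by rw [hL2a]; ring
  have hS0 : 0 ≤ d * ((L - 1 : ℕ) * a₀) + d * (((L - 1 : ℕ) * L) * a₀) + L * L * a₀ := by positivity
  have hSsq : (d * ((L - 1 : ℕ) * a₀) + d * (((L - 1 : ℕ) * L) * a₀) + L * L * a₀) ^ 2
      ≤ (4 * ((d : ℝ) + 1) * A / s ^ 2) ^ 2 := pow_le_pow_left₀ hS0 hS 2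
  have h44 : (4 * ((d : ℝ) + 1) * A / s ^ 2) ^ 2 = 16 * ((d : ℝ) + 1) ^ 2 * A ^ 2 / s ^ 4 := by
    field_simp; ring
  have hs43 : 16 * ((d : ℝ) + 1) ^ 2 * A ^ 2 / s ^ 4 ≤ 16 * ((d : ℝ) + 1) ^ 2 * A ^ 2 / s ^ 3 :=
    div_le_div_of_nonneg_left (by positivity) (by positivity) (pow_le_pow_right₀ hs (by norm_num))
  calc _ ≤ 24 * d * G₀ / s ^ 3 + 14 * (16 * ((d : ℝ) + 1) ^ 2 * A ^ 2 / s ^ 3) := by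
        have := hSsq.trans (h44.le.trans hs43)
        linarith
    _ = (24 * d * G₀ + 224 * ((d : ℝ) + 1) ^ 2 * A ^ 2) / s ^ 3 := by ring

/-! ## §2 Root-closeness of the filling of the pre-compensated datum of a regular coarse field -/

/-- **ROOT-CLOSENESS OF THE FILLING** (hypothesis `hρ` of part 3b's `approxRefine_of_rootClose`, DISCHARGED): for a
class-`j` datum `U` with `RegularSup d L N b c j U` (`0 ≤ b, c`, `(d−1)b ≤ 1/32`, `(8d−7)b ≤ 1/4`), `T = precomp L U`,
`h = rootH L T`, `W = fullFill L T h`: for every coarse site `z`, in-box `q` and plane `μ < ν`,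
`‖W(∂p_{μν}(L•z+q)) − h(z;μ,ν)‖ ≤ (24dG₀ + 224(d+1)²A²)/(L^j)³`, `A = (8d−7)b`, `G₀ = (2d−1)c + gradRem(d)b²` —
row S4d's F4e `norm_plaq_sub_root_le` at part 2b's root data, the root identity `h^{L²} = T(∂p)` from `rootH_pow`,
then §1. [folklore] -/
theorem rootClose_fill_of_regularSup [Nonempty n] {L N : ℕ} (hL : 1 ≤ L) {b c : ℝ} (hb : 0 ≤ b) (hc : 0 ≤ c)
    (hdb : ((d : ℝ) - 1) * b ≤ 1 / 32) (hdT : (8 * (d : ℝ) - 7) * b ≤ 1 / 4)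
    {j : ℕ} {U : B7Prop1Explicit.Site d → Fin d → (Matrix n n ℂ)ˣ} (hreg : RegularSup d L N b c j U)
    (z q : B7Prop1Explicit.Site d) (μ ν : Fin d) (hμν : μ < ν) (hq : InBox L q) :
    ‖((hol (fullFill L (precomp L U) (rootH L (precomp L U))) ((L : ℤ) • z + q) (plaqWord μ ν) : (Matrix n n ℂ)ˣ) :
        Matrix n n ℂ) - ((rootH L (precomp L U) z μ ν : (Matrix n n ℂ)ˣ) : Matrix n n ℂ)‖
      ≤ (24 * d * ((2 * (d : ℝ) - 1) * c + gradRem d * b ^ 2) + 224 * ((d : ℝ) + 1) ^ 2 * ((8 * (d : ℝ) - 7) * b) ^ 2)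
          / ((L : ℝ) ^ j) ^ 3 := by
  have hL1 : (1 : ℝ) ≤ L := by exact_mod_cast hL
  obtain ⟨hTu, hTa, hTδ⟩ := rootData_precomp hL hreg.unitary hb j hreg.small hreg.grad hdb hdT
  have hs1 : (1 : ℝ) ≤ (L : ℝ) ^ j := one_le_pow₀ hL1
  rcases Nat.eq_zero_or_pos d with hd | hd
  · subst hd; exact μ.elim0
  have hd1' : (1 : ℝ) ≤ d := by exact_mod_cast hd
  have hA0 : 0 ≤ (8 * (d : ℝ) - 7) * b := mul_nonneg (by linarith) hb
  have hG0 : 0 ≤ (2 * (d : ℝ) - 1) * c + gradRem d * b ^ 2 :=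
    add_nonneg (mul_nonneg (by linarith) hc) (mul_nonneg (gradRem_nonneg hd) (sq_nonneg b))
  have hsmallT : (8 * (d : ℝ) - 7) * (b / ((L : ℝ) ^ j) ^ 2) ≤ 1 / 4 :=
    (mul_le_mul_of_nonneg_left (div_le_self hb (one_le_pow₀ hs1)) (by linarith)).trans hdT
  have hD := skeletonDatum_precomp_of_regularSup (d := d) hL hb hreg hsmallT
  have hh : ∀ (z : B7Prop1Explicit.Site d) (κ ν : Fin d),
      rootH L (precomp L U) z κ ν ∈ unitaryUnits (Matrix n n ℂ) :=
    fun z κ ν => rootH_mem_unitary hTu z κ ν (hD.small_all z κ ν)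
  have hroot : ∀ (z : B7Prop1Explicit.Site d) (κ ι : Fin d), κ < ι →
      (rootH L (precomp L U) z κ ι) ^ (L * L) = hol (precomp L U) z (plaqWord κ ι) :=
    fun z κ ι _ => rootH_pow hL _ z κ ι (lt_of_le_of_lt (hD.small_all z κ ι) (by norm_num))
  have ha0 : 0 ≤ rootCoeff L * (4 * ((8 * (d : ℝ) - 7) * b / ((L : ℝ) ^ j) ^ 2)) :=
    mul_nonneg (rootCoeff_nonneg L) (mul_nonneg (by norm_num) (div_nonneg hA0 (by positivity)))
  have hδ0 : 0 ≤ 12 * rootCoeff L * (((2 * (d : ℝ) - 1) * c + gradRem d * b ^ 2) / ((L : ℝ) ^ j) ^ 3) :=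
    mul_nonneg (mul_nonneg (by norm_num) (rootCoeff_nonneg L)) (div_nonneg hG0 (by positivity))
  have h := norm_plaq_sub_root_le hL hTu hh hTa ha0 hTδ hδ0 hroot z hq hμν
  exact h.trans (scale_rootClose d L hL hs1 hA0 hG0)

/-! ## §3 THE R1 END -/

/-- **LEAF R1, NON-ABELIAN END — `ApproxRefine` FOR THE SMALL-FIELD CLASSES, UNCONDITIONAL modulo displayed numeric
smallness.**  With `A = (8d−7)b`, `G₀ = (2d−1)c + gradRem(d)b²`, `r = 24dG₀ + 224(d+1)²A²`,
`b₁ = 4A + 48dL²G₀ + 128(2d+1)²L²A²`, `c₁ = L³(32dA(4A + r + 12G₀) + 4r + 24G₀)`,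
`m = 3(1280d(d+1)²(d+4)²L²b₁² + d(d+1)c₁ + (d−1)²(c + (37(d−1)+4)b²))`:
`ApproxRefine d (sfClass d L N ε) L N b c b₁ c₁ m` for every `ε` and every `N`, from `1 ≤ d`, `1 ≤ L`, `0 ≤ b, c` and
the five `j`-uniform inequalities `h16 hdb hquarter hhalf h512` — part 3b's `approxRefine_of_rootClose` at
`hρ := rootClose_fill_of_regularSup`.  The witness is `W = fullFill L (precomp L U) (rootH L (precomp L U))` (leaf-07's
closed-form two-stage geodesic filling of leaf-01's pre-compensated 1-skeleton datum). [folklore] -/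
theorem approxRefine_sfClass [Nonempty n] (hd1 : 1 ≤ d) (L N : ℕ) (hL : 1 ≤ L) {ε b c : ℝ}
    (hb : 0 ≤ b) (hc : 0 ≤ c)
    (h16 : (8 * (d : ℝ) - 7) * b ≤ 1 / 16) (hdb : ((d : ℝ) - 1) * b ≤ 1 / 32)
    (hquarter : 2 * (precompCoeff L * (((d : ℝ) - 1) * c)) + 37 * (((d : ℝ) - 1) * b) ^ 2
      + 4 * b * (((d : ℝ) - 1) * b) ≤ 1 / 4)
    (hhalf : 4 * ((8 * (d : ℝ) - 7) * b)
        + (24 * d * ((2 * (d : ℝ) - 1) * c + gradRem d * b ^ 2) + 224 * ((d : ℝ) + 1) ^ 2 * ((8 * (d : ℝ) - 7) * b) ^ 2)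
        + 12 * ((2 * (d : ℝ) - 1) * c + gradRem d * b ^ 2) ≤ 1 / 2)
    (h512 : 512 * (d + 1) * (d + 4) * (L : ℝ) ^ 2
      * (4 * (8 * (d : ℝ) - 7) * b + 48 * d * (L : ℝ) ^ 2 * ((2 * (d : ℝ) - 1) * c + gradRem d * b ^ 2)
        + 128 * (2 * (d : ℝ) + 1) ^ 2 * (L : ℝ) ^ 2 * ((8 * (d : ℝ) - 7) * b) ^ 2) ≤ 1) :
    ApproxRefine d (sfClass (d := d) (n := n) L N ε) L N b c
      (4 * (8 * (d : ℝ) - 7) * b + 48 * d * (L : ℝ) ^ 2 * ((2 * (d : ℝ) - 1) * c + gradRem d * b ^ 2)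
        + 128 * (2 * (d : ℝ) + 1) ^ 2 * (L : ℝ) ^ 2 * ((8 * (d : ℝ) - 7) * b) ^ 2)
      ((L : ℝ) ^ 3 * (32 * d * ((8 * (d : ℝ) - 7) * b)
            * (4 * ((8 * (d : ℝ) - 7) * b)
              + (24 * d * ((2 * (d : ℝ) - 1) * c + gradRem d * b ^ 2) + 224 * ((d : ℝ) + 1) ^ 2 * ((8 * (d : ℝ) - 7) * b) ^ 2)
              + 12 * ((2 * (d : ℝ) - 1) * c + gradRem d * b ^ 2))
          + 4 * (24 * d * ((2 * (d : ℝ) - 1) * c + gradRem d * b ^ 2) + 224 * ((d : ℝ) + 1) ^ 2 * ((8 * (d : ℝ) - 7) * b) ^ 2)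
          + 24 * ((2 * (d : ℝ) - 1) * c + gradRem d * b ^ 2)))
      (3 * (1280 * d * ((d : ℝ) + 1) ^ 2 * ((d : ℝ) + 4) ^ 2 * (L : ℝ) ^ 2
          * (4 * (8 * (d : ℝ) - 7) * b + 48 * d * (L : ℝ) ^ 2 * ((2 * (d : ℝ) - 1) * c + gradRem d * b ^ 2)
        + 128 * (2 * (d : ℝ) + 1) ^ 2 * (L : ℝ) ^ 2 * ((8 * (d : ℝ) - 7) * b) ^ 2) ^ 2
        + d * ((d : ℝ) + 1) * ((L : ℝ) ^ 3 * (32 * d * ((8 * (d : ℝ) - 7) * b)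
            * (4 * ((8 * (d : ℝ) - 7) * b)
              + (24 * d * ((2 * (d : ℝ) - 1) * c + gradRem d * b ^ 2) + 224 * ((d : ℝ) + 1) ^ 2 * ((8 * (d : ℝ) - 7) * b) ^ 2)
              + 12 * ((2 * (d : ℝ) - 1) * c + gradRem d * b ^ 2))
          + 4 * (24 * d * ((2 * (d : ℝ) - 1) * c + gradRem d * b ^ 2) + 224 * ((d : ℝ) + 1) ^ 2 * ((8 * (d : ℝ) - 7) * b) ^ 2)
          + 24 * ((2 * (d : ℝ) - 1) * c + gradRem d * b ^ 2)))
        + ((d : ℝ) - 1) ^ 2 * (c + (37 * ((d : ℝ) - 1) + 4) * b ^ 2))) := by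
  have hd1' : (1 : ℝ) ≤ d := by exact_mod_cast hd1
  have hdT : (8 * (d : ℝ) - 7) * b ≤ 1 / 4 := h16.trans (by norm_num)
  have hA0 : 0 ≤ (8 * (d : ℝ) - 7) * b := mul_nonneg (by linarith) hb
  have hG0 : 0 ≤ (2 * (d : ℝ) - 1) * c + gradRem d * b ^ 2 :=
    add_nonneg (mul_nonneg (by linarith) hc) (mul_nonneg (gradRem_nonneg hd1) (sq_nonneg b))
  have hr : 0 ≤ (24 * d * ((2 * (d : ℝ) - 1) * c + gradRem d * b ^ 2) + 224 * ((d : ℝ) + 1) ^ 2 * ((8 * (d : ℝ) - 7) * b) ^ 2) := by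
    positivity
  exact approxRefine_of_rootClose hd1 L N hL hb hc hr h16 hdb hquarter hhalf h512
    (fun j U _ hreg z q μ ν hμν hq => rootClose_fill_of_regularSup hL hb hc hdb hdT hreg z q μ ν hμν hq)

/-! ## §4 The R1 END under ONE threshold -/

/-- **LEAF R1 UNDER ONE THRESHOLD**: for `1 ≤ d`, `1 ≤ L`, `0 ≤ b ≤ t`, `0 ≤ c ≤ t` and `K(d, L)·t ≤ 1` with the explicit
`K` of `ApproxRefineRegime.sideConds_of_small` (`K ≈ 3.7·10¹²` at `d = 4`, `L = 2`, i.e. `t ≤ 2.7·10⁻¹³`):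
`ApproxRefine d (sfClass d L N ε) L N b c b₁ c₁ m` with the closed `b₁ c₁ m` of `approxRefine_sfClass` — the five numeric
inequalities discharged by `sideConds_of_small`; `ApproxRefineRegime.fillRadius_le_of_small` ∕ `gradRadius_le_of_small`
bound `b₁, c₁` linearly in `t` for the owner's regime. [folklore] -/
theorem approxRefine_sfClass_of_small [Nonempty n] (hd1 : 1 ≤ d) (L N : ℕ) (hL : 1 ≤ L) {ε b c t : ℝ}
    (hb : 0 ≤ b) (hc : 0 ≤ c) (hbt : b ≤ t) (hct : c ≤ t)
    (hK : (160 * d + 168 * (d : ℝ) ^ 2 + 2 * (32 * d + (24 * d * (2 * (d : ℝ) + gradRem d) + 14336 * (d : ℝ) ^ 2 * ((d : ℝ) + 1) ^ 2)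
            + 12 * (2 * (d : ℝ) + gradRem d))
        + 512 * ((d : ℝ) + 1) * ((d : ℝ) + 4) * (L : ℝ) ^ 2
          * (32 * d + 48 * d * (L : ℝ) ^ 2 * (2 * (d : ℝ) + gradRem d)
            + 8192 * (d : ℝ) ^ 2 * (2 * (d : ℝ) + 1) ^ 2 * (L : ℝ) ^ 2)) * t ≤ 1) :
    ApproxRefine d (sfClass (d := d) (n := n) L N ε) L N b c
      (4 * (8 * (d : ℝ) - 7) * b + 48 * d * (L : ℝ) ^ 2 * ((2 * (d : ℝ) - 1) * c + gradRem d * b ^ 2)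
        + 128 * (2 * (d : ℝ) + 1) ^ 2 * (L : ℝ) ^ 2 * ((8 * (d : ℝ) - 7) * b) ^ 2)
      ((L : ℝ) ^ 3 * (32 * d * ((8 * (d : ℝ) - 7) * b)
            * (4 * ((8 * (d : ℝ) - 7) * b)
              + (24 * d * ((2 * (d : ℝ) - 1) * c + gradRem d * b ^ 2) + 224 * ((d : ℝ) + 1) ^ 2 * ((8 * (d : ℝ) - 7) * b) ^ 2)
              + 12 * ((2 * (d : ℝ) - 1) * c + gradRem d * b ^ 2))
          + 4 * (24 * d * ((2 * (d : ℝ) - 1) * c + gradRem d * b ^ 2) + 224 * ((d : ℝ) + 1) ^ 2 * ((8 * (d : ℝ) - 7) * b) ^ 2)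
          + 24 * ((2 * (d : ℝ) - 1) * c + gradRem d * b ^ 2)))
      (3 * (1280 * d * ((d : ℝ) + 1) ^ 2 * ((d : ℝ) + 4) ^ 2 * (L : ℝ) ^ 2
          * (4 * (8 * (d : ℝ) - 7) * b + 48 * d * (L : ℝ) ^ 2 * ((2 * (d : ℝ) - 1) * c + gradRem d * b ^ 2)
        + 128 * (2 * (d : ℝ) + 1) ^ 2 * (L : ℝ) ^ 2 * ((8 * (d : ℝ) - 7) * b) ^ 2) ^ 2
        + d * ((d : ℝ) + 1) * ((L : ℝ) ^ 3 * (32 * d * ((8 * (d : ℝ) - 7) * b)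
            * (4 * ((8 * (d : ℝ) - 7) * b)
              + (24 * d * ((2 * (d : ℝ) - 1) * c + gradRem d * b ^ 2) + 224 * ((d : ℝ) + 1) ^ 2 * ((8 * (d : ℝ) - 7) * b) ^ 2)
              + 12 * ((2 * (d : ℝ) - 1) * c + gradRem d * b ^ 2))
          + 4 * (24 * d * ((2 * (d : ℝ) - 1) * c + gradRem d * b ^ 2) + 224 * ((d : ℝ) + 1) ^ 2 * ((8 * (d : ℝ) - 7) * b) ^ 2)
          + 24 * ((2 * (d : ℝ) - 1) * c + gradRem d * b ^ 2)))
        + ((d : ℝ) - 1) ^ 2 * (c + (37 * ((d : ℝ) - 1) + 4) * b ^ 2))) := by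
  obtain ⟨h16, hdb, hquarter, hhalf, h512⟩ := sideConds_of_small hd1 hL hb hc hbt hct hK
  exact approxRefine_sfClass hd1 L N hL hb hc h16 hdb hquarter hhalf h512

end

end Summit.QuantumFields.BalabanUV.T4Continuum.ApproxRefineEnd
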